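import Literature.NumberTheory.Automorphic.BlockUnipotentArchimedean
import Literature.NumberTheory.Automorphic.BlockUnipotentDomains
import Literature.NumberTheory.Automorphic.TestFunctionLieDeriv
import Literature.NumberTheory.Automorphic.TestFunctionGLArchSlice
import Literature.NumberTheory.Automorphic.AutomorphicFormsL2Derivative
import HarnessLib

/-!
# Archimedean block unipotents of `GL_n(𝔸_K)` and the derivative of a smooth function along them
(Moeglin–Waldspurger, *Spectral decomposition and Eisenstein series* (1995), proof of Lemma I.2.10:
the function `x ↦ φ(exp(∑ x_ℓ X_{iℓ}) a g)` on the torus and its derivatives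
`δ(X'^h) φ`, `X' = Ad(g_∞⁻¹) X`)

Topic `NumberTheory/Automorphic`; a brick of the discharge of the named fact
`AutomorphicRepsGL.rapidlyDecreasingOnSiegelSets_of_cuspidal` (MW Cor. I.2.12 for `GL_n`, the input
of Getz–Hahn's Thm. 9.8.1 `cuspidal_rapidlyDecreasing`). For the unipotent radical `N_k = 1 + 𝔫_k`
of the standard maximal parabolic `P_k` of `GL_n` (`blockNilpotent`, `glUnipotent` of
`GLnCuspidalSpectrum`) we set up the real-analytic parametrisation of its archimedean part used in
MW's proof of Lemma I.2.10:

* `ArchBlockSpace n k K = (BlockPos n k → mixedSpace K)` — the real vector space of archimedean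
  block coordinates (`mixedSpace K = ℝ^{r₁} × ℂ^{r₂} ≅ K_∞`), `blockMatrixOf e ∈ M_n(K_∞)` the
  block matrix with these entries (square zero), `archBlock e ∈ 𝔫_k(𝔸_K)` the block-nilpotent
  adelic matrix with archimedean entries `e` and trivial finite entries, and
  `archUnipotent e = 1 + archBlock e ∈ GL_n(𝔸_K)` — an additive-to-multiplicative homomorphism
  commuting with all of `N_k(𝔸_K)`, equal to the archimedean element `(1 + blockMatrixOf e, 1)`
  (`archUnipotent_eq_ofInfinite`); `archBlock (archCoords X) = X_∞` (`archBlock_archCoords`).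
* `twistedBlockDir g b = g_∞⁻¹ · blockMatrixOf b · g_∞ ∈ 𝔤𝔩_n(K_∞)` — MW's `X' = Ad(g_∞⁻¹) X`
  (MW p. 36), of square zero, so `exp(t X') = 1 + t X'` (`coe_expGL_smul_twistedBlockDir`) and
  **`g⁻¹ (1 + t·b) g = (exp(t X'), 1)`** (`inv_mul_archUnipotent_smul_mul`), whence
  `(1 + (e + s b)) g = ((1 + e) g) · (exp(s X'), 1)` (`archUnipotent_add_smul_mul`).
* **The derivative chain** (MW: "via integration by parts …
  `d^h/dx^h φ(exp(∑ x_ℓ X_{iℓ}) a g) = δ(X'^h) φ(…)`"): for `ψ` smooth in the archimedean variable,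
  `s ↦ ψ((1 + (e + s b)) g)` has derivative `(X' ψ)((1 + (e + s b)) g)`
  (`IsArchSmooth.hasDerivAt_archUnipotent`, from `IsArchSmooth.hasDerivAt_expMem_smul`), and with
  `blockDerivChain ψ g b j = X'^j ψ` (iterated Lie derivative, again smooth) the functions
  `s ↦ (X'^j ψ)((1 + (e + s b)) g)` form a chain of derivatives
  (`IsArchSmooth.hasDerivAt_blockDerivChain`) — the input format of the torus lemma
  `norm_sub_le_sum_of_derivChains` of `PeriodicDerivativeChain`.

Everything here is proved (definitions with unfolding lemmas, and theorems).

## References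

* C. Moeglin, J.-L. Waldspurger, *Spectral decomposition and Eisenstein series*, Cambridge Tracts
  in Math. 113 (1995), proof of Lemma I.2.10 (assertion (1) and the integration by parts)
  [MoeglinWaldspurger1995].
* A. Borel, H. Jacquet, *Automorphic forms and automorphic representations*, Proc. Sympos. Pure
  Math. 33 (1979), Part 1, §1.5 (Lie derivatives) [BorelJacquet1979].
-/

noncomputable section

open scoped MatrixGroups Matrix Classical
open NumberField NumberField.mixedEmbedding IsDedekindDomain Set

namespace Literature.NumberTheory.Automorphic

/-! ### 1. Archimedean block coordinates -/

section Coordinates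

variable (n k : ℕ) (K : Type) [Field K] [NumberField K]

/-- The positions `(i, j)`, `i < k ≤ j`, of the block `𝔫_k` of the standard maximal parabolic `P_k`
of `GL_n`. [folklore] -/
abbrev BlockPos : Type := {p : Fin n × Fin n // (p.1 : ℕ) < k ∧ k ≤ (p.2 : ℕ)}

/-- **Archimedean block coordinates**: the real vector space `(BlockPos → K_∞)`,
`K_∞ ≅ mixedSpace K = ℝ^{r₁} × ℂ^{r₂}`, i.e. `Lie(U(𝔸_∞))` for `U = N_k` in the notation of
Moeglin–Waldspurger I.2.10. [cite: MoeglinWaldspurger1995, proof of Lemma I.2.10] -/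
abbrev ArchBlockSpace : Type := BlockPos n k → mixedSpace K

/-- The block matrix `blockMatrixOf e ∈ M_n(K_∞)` with entries `e` on the block `i < k ≤ j` and `0`
elsewhere; real-linear in `e`. [folklore] -/
def blockMatrixOf : ArchBlockSpace n k K →ₗ[ℝ] Matrix (Fin n) (Fin n) (mixedSpace K) where
  toFun e := Matrix.of fun i j => if h : (i : ℕ) < k ∧ k ≤ (j : ℕ) then e ⟨(i, j), h⟩ else 0
  map_add' e e' := by
    refine Matrix.ext fun i j => ?_
    simp only [Matrix.of_apply, Matrix.add_apply, Pi.add_apply]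
    split_ifs <;> simp
  map_smul' c e := by
    refine Matrix.ext fun i j => ?_
    simp only [Matrix.of_apply, Matrix.smul_apply, Pi.smul_apply, RingHom.id_apply]
    split_ifs <;> simp

variable {n k K}

omit [NumberField K] in
/-- Entries of `blockMatrixOf e` on the block. [folklore] -/
theorem blockMatrixOf_apply_of_mem (e : ArchBlockSpace n k K) {i j : Fin n}
    (h : (i : ℕ) < k ∧ k ≤ (j : ℕ)) : blockMatrixOf n k K e i j = e ⟨(i, j), h⟩ := by
  change (if h : (i : ℕ) < k ∧ k ≤ (j : ℕ) then e ⟨(i, j), h⟩ else 0) = _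
  rw [dif_pos h]

omit [NumberField K] in
/-- Entries of `blockMatrixOf e` off the block vanish. [folklore] -/
theorem blockMatrixOf_apply_of_not (e : ArchBlockSpace n k K) {i j : Fin n}
    (h : ¬((i : ℕ) < k ∧ k ≤ (j : ℕ))) : blockMatrixOf n k K e i j = 0 := by
  change (if h : (i : ℕ) < k ∧ k ≤ (j : ℕ) then e ⟨(i, j), h⟩ else 0) = _
  rw [dif_neg h]

omit [NumberField K] in
/-- The coordinate `p` of `blockMatrixOf e` is `e p`. [folklore] -/
@[simp]
theorem blockMatrixOf_apply_coe (e : ArchBlockSpace n k K) (p : BlockPos n k) :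
    blockMatrixOf n k K e p.1.1 p.1.2 = e p := by
  rw [blockMatrixOf_apply_of_mem e p.2]

omit [NumberField K] in
/-- **Block matrices have square zero** (`𝔫_k² = 0`: a non-zero term of `∑_l M_{il} M'_{lj}` needs
`k ≤ l` and `l < k`). [folklore] -/
theorem blockMatrixOf_mul_blockMatrixOf (e e' : ArchBlockSpace n k K) :
    blockMatrixOf n k K e * blockMatrixOf n k K e' = 0 := by
  refine Matrix.ext fun i j => ?_
  rw [Matrix.mul_apply, Matrix.zero_apply]
  refine Finset.sum_eq_zero fun l _ => ?_
  by_cases hl : k ≤ (l : ℕ)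
  · rw [blockMatrixOf_apply_of_not e' (fun h => absurd h.1 (not_lt.2 hl)), mul_zero]
  · rw [blockMatrixOf_apply_of_not e (fun h => hl h.2), zero_mul]

variable (n k K)

/-- **The adelic block matrix with archimedean entries `e` and trivial finite entries**,
`archBlock e ∈ 𝔫_k(𝔸_K)` (entries `((e_{ij})_{K_∞}, 0)` through Mathlib's
`ringEquiv_mixedSpace : K_∞ ≃+* mixedSpace K`); an additive homomorphism. [folklore] -/
def archBlock : ArchBlockSpace n k K →+ blockNilpotent n k (AdeleRing (𝓞 K) K) where
  toFun e := ⟨Matrix.of fun i j =>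
      ((((InfiniteAdeleRing.ringEquiv_mixedSpace K).symm (blockMatrixOf n k K e i j),
        (0 : FiniteAdeleRing (𝓞 K) K)) : AdeleRing (𝓞 K) K)),
    fun i j hij => by
      by_contra h
      refine hij ?_
      rw [Matrix.of_apply, blockMatrixOf_apply_of_not e h, map_zero]
      rfl⟩
  map_zero' := by
    refine Subtype.ext (Matrix.ext fun i j => ?_)
    change ((((InfiniteAdeleRing.ringEquiv_mixedSpace K).symm (blockMatrixOf n k K 0 i j), 0) :
      AdeleRing (𝓞 K) K)) = 0
    rw [map_zero, Matrix.zero_apply, map_zero]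
    rfl
  map_add' e e' := by
    refine Subtype.ext (Matrix.ext fun i j => ?_)
    change ((((InfiniteAdeleRing.ringEquiv_mixedSpace K).symm (blockMatrixOf n k K (e + e') i j), 0) :
      AdeleRing (𝓞 K) K)) =
      (((InfiniteAdeleRing.ringEquiv_mixedSpace K).symm (blockMatrixOf n k K e i j), 0) : AdeleRing (𝓞 K) K) +
        (((InfiniteAdeleRing.ringEquiv_mixedSpace K).symm (blockMatrixOf n k K e' i j), 0) : AdeleRing (𝓞 K) K)
    rw [map_add, Matrix.add_apply, map_add]
    refine Prod.ext rfl ?_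
    change (0 : FiniteAdeleRing (𝓞 K) K) = 0 + 0
    rw [add_zero]

variable {n k K}

/-- Archimedean entries of `archBlock e`. [folklore] -/
@[simp]
theorem fst_archBlock_apply (e : ArchBlockSpace n k K) (i j : Fin n) :
    (((archBlock n k K e : blockNilpotent n k (AdeleRing (𝓞 K) K)) :
        Matrix (Fin n) (Fin n) (AdeleRing (𝓞 K) K)) i j).1 =
      (InfiniteAdeleRing.ringEquiv_mixedSpace K).symm (blockMatrixOf n k K e i j) :=
  rfl

/-- The finite entries of `archBlock e` vanish. [folklore] -/
@[simp]
theorem snd_archBlock_apply (e : ArchBlockSpace n k K) (i j : Fin n) :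
    (((archBlock n k K e : blockNilpotent n k (AdeleRing (𝓞 K) K)) :
        Matrix (Fin n) (Fin n) (AdeleRing (𝓞 K) K)) i j).2 = 0 :=
  rfl

/-- **The archimedean matrix of `archBlock e` is `blockMatrixOf e`.** [folklore] -/
@[simp]
theorem blockArchMatrix_archBlock (e : ArchBlockSpace n k K) :
    blockArchMatrix n k K (archBlock n k K e) = blockMatrixOf n k K e := by
  refine Matrix.ext fun i j => ?_
  rw [blockArchMatrix_apply, fst_archBlock_apply, RingEquiv.apply_symm_apply]

/-- `archBlock e` is its own archimedean part. [folklore] -/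
theorem blockArchPart_archBlock (e : ArchBlockSpace n k K) :
    blockArchPart (archBlock n k K e) = archBlock n k K e :=
  Subtype.ext (Matrix.ext fun _ _ => rfl)

/-- `archBlock e` has no finite part. [folklore] -/
theorem blockFinPart_archBlock (e : ArchBlockSpace n k K) :
    blockFinPart (archBlock n k K e) = 0 :=
  Subtype.ext (Matrix.ext fun _ _ => rfl)

variable (n k K) in
/-- **The archimedean block coordinates of `X ∈ 𝔫_k(𝔸_K)`**: the archimedean components of its
block entries, read in `mixedSpace K`; an additive homomorphism. [folklore] -/
def archCoords : blockNilpotent n k (AdeleRing (𝓞 K) K) →+ ArchBlockSpace n k K where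
  toFun X p := InfiniteAdeleRing.ringEquiv_mixedSpace K
    ((((X : Matrix (Fin n) (Fin n) (AdeleRing (𝓞 K) K)) p.1.1 p.1.2).1))
  map_zero' := by
    funext p
    change InfiniteAdeleRing.ringEquiv_mixedSpace K
      (((0 : Matrix (Fin n) (Fin n) (AdeleRing (𝓞 K) K)) p.1.1 p.1.2).1) = 0
    rw [Matrix.zero_apply]
    exact map_zero _
  map_add' X Y := by
    funext p
    change InfiniteAdeleRing.ringEquiv_mixedSpace K
      ((((X : Matrix (Fin n) (Fin n) (AdeleRing (𝓞 K) K)) +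
        (Y : Matrix (Fin n) (Fin n) (AdeleRing (𝓞 K) K))) p.1.1 p.1.2).1) = _
    rw [Matrix.add_apply]
    exact map_add _ _ _

/-- `archCoords X p` is the archimedean component of the entry of `X` at `p`. [folklore] -/
@[simp]
theorem archCoords_apply (X : blockNilpotent n k (AdeleRing (𝓞 K) K)) (p : BlockPos n k) :
    archCoords n k K X p = InfiniteAdeleRing.ringEquiv_mixedSpace K
      ((((X : Matrix (Fin n) (Fin n) (AdeleRing (𝓞 K) K)) p.1.1 p.1.2).1)) :=
  rfl

/-- `blockMatrixOf (archCoords X)` is the archimedean matrix of `X`. [folklore] -/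
theorem blockMatrixOf_archCoords (X : blockNilpotent n k (AdeleRing (𝓞 K) K)) :
    blockMatrixOf n k K (archCoords n k K X) = blockArchMatrix n k K X := by
  refine Matrix.ext fun i j => ?_
  by_cases h : (i : ℕ) < k ∧ k ≤ (j : ℕ)
  · rw [blockMatrixOf_apply_of_mem _ h, archCoords_apply, blockArchMatrix_apply]
  · rw [blockMatrixOf_apply_of_not _ h, blockArchMatrix_apply_eq_zero h]

/-- **`archBlock (archCoords X) = X_∞`**: the adelic block matrix built from the archimedean
coordinates of `X` is the archimedean part of `X` (`blockArchPart`). [folklore] -/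
theorem archBlock_archCoords (X : blockNilpotent n k (AdeleRing (𝓞 K) K)) :
    archBlock n k K (archCoords n k K X) = blockArchPart X := by
  refine Subtype.ext (Matrix.ext fun i j => Prod.ext ?_ rfl)
  rw [fst_archBlock_apply, fst_blockArchPart_apply]
  by_cases h : (i : ℕ) < k ∧ k ≤ (j : ℕ)
  · rw [blockMatrixOf_apply_of_mem _ h, archCoords_apply, RingEquiv.symm_apply_apply]
  · rw [blockMatrixOf_apply_of_not _ h, map_zero, apply_eq_zero_of_mem_blockNilpotent X.2 h]
    rfl

/-- `archCoords (archBlock e) = e`. [folklore] -/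
@[simp]
theorem archCoords_archBlock (e : ArchBlockSpace n k K) : archCoords n k K (archBlock n k K e) = e := by
  funext p
  rw [archCoords_apply, fst_archBlock_apply, RingEquiv.apply_symm_apply, blockMatrixOf_apply_coe]

end Coordinates

/-! ### 2. Archimedean block unipotents -/

section Unipotent

variable (n k : ℕ) (K : Type) [Field K] [NumberField K]

/-- **The archimedean block unipotent** `archUnipotent e = 1 + archBlock e ∈ N_k(𝔸_K) ≤ GL_n(𝔸_K)`
with archimedean block `e` and trivial finite part (MW's `exp(∑ x_ℓ X_{iℓ})`).
[cite: MoeglinWaldspurger1995, proof of Lemma I.2.10] -/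
def archUnipotent (e : ArchBlockSpace n k K) : GL (Fin n) (AdeleRing (𝓞 K) K) :=
  glUnipotent n k K (Multiplicative.ofAdd (archBlock n k K e))

variable {n k K}

/-- `archUnipotent e = glUnipotent (archBlock e)` (definitional). [folklore] -/
theorem archUnipotent_def (e : ArchBlockSpace n k K) :
    archUnipotent n k K e = glUnipotent n k K (Multiplicative.ofAdd (archBlock n k K e)) :=
  rfl

/-- **`e ↦ 1 + archBlock e` is a homomorphism**: `archUnipotent (e + e') = archUnipotent e * archUnipotent e'`
(`N_k` is abelian and `X ↦ 1 + X` is a homomorphism, `glUnipotent`). [folklore] -/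
theorem archUnipotent_add (e e' : ArchBlockSpace n k K) :
    archUnipotent n k K (e + e') = archUnipotent n k K e * archUnipotent n k K e' := by
  rw [archUnipotent_def, map_add, ofAdd_add, map_mul]
  rfl

/-- `archUnipotent 0 = 1`. [folklore] -/
@[simp]
theorem archUnipotent_zero : archUnipotent n k K 0 = 1 := by
  rw [archUnipotent_def, map_zero, ofAdd_zero, map_one]
  rfl

/-- Archimedean block unipotents commute with all block unipotents (`N_k(𝔸_K)` is abelian).
[folklore] -/
theorem archUnipotent_commute_glUnipotent (e : ArchBlockSpace n k K)
    (X : blockNilpotent n k (AdeleRing (𝓞 K) K)) :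
    Commute (archUnipotent n k K e) (glUnipotent n k K (Multiplicative.ofAdd X)) :=
  (Commute.all (Multiplicative.ofAdd (archBlock n k K e)) (Multiplicative.ofAdd X)).map
    (glUnipotent n k K)

/-- **An archimedean block unipotent is the archimedean element `(1 + blockMatrixOf e, 1)`**
(`unipotentOfBlock_eq_ofInfinite`: its finite entries vanish). [folklore] -/
theorem archUnipotent_eq_ofInfinite (e : ArchBlockSpace n k K) :
    archUnipotent n k K e = GLn.ofInfinite n K (unitOneAddBlock (archBlock n k K e)) :=
  unipotentOfBlock_eq_ofInfinite (snd_archBlock_apply e)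

/-- The matrix of `unitOneAddBlock (archBlock e)` is `1 + blockMatrixOf e`. [folklore] -/
theorem coe_unitOneAddBlock_archBlock (e : ArchBlockSpace n k K) :
    (unitOneAddBlock (archBlock n k K e) : Matrix (Fin n) (Fin n) (mixedSpace K)) =
      1 + blockMatrixOf n k K e := by
  rw [coe_unitOneAddBlock, blockArchMatrix_archBlock]

/-- The archimedean component of `archUnipotent e` is `1 + blockMatrixOf e`. [folklore] -/
theorem toMixed_archUnipotent (e : ArchBlockSpace n k K) :
    GLn.toMixed n K (archUnipotent n k K e) = unitOneAddBlock (archBlock n k K e) := by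
  rw [archUnipotent_eq_ofInfinite, GLn.toMixed_ofInfinite]

/-- `archUnipotent e` depends continuously on `e` (a continuous image of `GL_n(K_∞)`). [folklore] -/
theorem continuous_archUnipotent : Continuous (archUnipotent n k K) := by
  have hB : Continuous (blockMatrixOf n k K) := (blockMatrixOf n k K).continuous_of_finiteDimensional
  have h1 : Continuous fun e : ArchBlockSpace n k K => unitOneAddBlock (archBlock n k K e) := by
    refine Units.continuous_iff.2 ⟨?_, ?_⟩
    · change Continuous fun e : ArchBlockSpace n k K =>
        ((unitOneAddBlock (archBlock n k K e) : GL (Fin n) (mixedSpace K)) :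
          Matrix (Fin n) (Fin n) (mixedSpace K))
      have e1 : (fun e : ArchBlockSpace n k K =>
          ((unitOneAddBlock (archBlock n k K e) : GL (Fin n) (mixedSpace K)) :
            Matrix (Fin n) (Fin n) (mixedSpace K))) = fun e => 1 + blockMatrixOf n k K e :=
        funext fun e => coe_unitOneAddBlock_archBlock e
      rw [e1]
      exact continuous_const.add hB
    · have e2 : (fun e : ArchBlockSpace n k K =>
          (((unitOneAddBlock (archBlock n k K e))⁻¹ : GL (Fin n) (mixedSpace K)) :
            Matrix (Fin n) (Fin n) (mixedSpace K))) = fun e => 1 - blockMatrixOf n k K e :=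
        funext fun e => by
          change 1 - blockArchMatrix n k K (archBlock n k K e) = _
          rw [blockArchMatrix_archBlock]
      rw [e2]
      exact continuous_const.sub hB
  have h2 : archUnipotent n k K = fun e => GLn.ofInfinite n K (unitOneAddBlock (archBlock n k K e)) :=
    funext archUnipotent_eq_ofInfinite
  rw [h2]
  exact (GLn.continuous_ofInfinite n K).comp h1

end Unipotent

/-! ### 3. The twisted direction `X' = Ad(g_∞⁻¹) X` and conjugation into a one-parameter subgroup -/

section Twisted

variable {n k : ℕ} {K : Type} [Field K] [NumberField K]

variable (n k K) in
/-- **MW's twisted direction `X' = Ad(g_∞⁻¹) X`**: for `g ∈ GL_n(𝔸_K)` with archimedean component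
`g_∞ = GLn.toMixed g` and a block direction `b`, the matrix `g_∞⁻¹ · blockMatrixOf b · g_∞ ∈ 𝔤𝔩_n(K_∞)`
(Moeglin–Waldspurger (1995), proof of Lemma I.2.10, `X'_{iℓ(ξ)} = Ad(g_∞⁻¹) X_{iℓ(ξ)}`).
[cite: MoeglinWaldspurger1995, proof of Lemma I.2.10] -/
def twistedBlockDir (g : GL (Fin n) (AdeleRing (𝓞 K) K)) (b : ArchBlockSpace n k K) :
    Matrix (Fin n) (Fin n) (mixedSpace K) :=
  (((GLn.toMixed n K g)⁻¹ : GL (Fin n) (mixedSpace K)) : Matrix (Fin n) (Fin n) (mixedSpace K)) *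
    blockMatrixOf n k K b * ((GLn.toMixed n K g : GL (Fin n) (mixedSpace K)) : Matrix (Fin n) (Fin n) (mixedSpace K))

/-- `twistedBlockDir g b` is the conjugate `matrixConj g_∞⁻¹ (blockMatrixOf b)`. [folklore] -/
theorem twistedBlockDir_eq_matrixConj (g : GL (Fin n) (AdeleRing (𝓞 K) K)) (b : ArchBlockSpace n k K) :
    twistedBlockDir n k K g b = matrixConj n K (GLn.toMixed n K g)⁻¹ (blockMatrixOf n k K b) := by
  rw [matrixConj_apply, inv_inv, twistedBlockDir]

/-- `twistedBlockDir g` is real-linear in the direction. [folklore] -/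
theorem twistedBlockDir_smul (g : GL (Fin n) (AdeleRing (𝓞 K) K)) (t : ℝ) (b : ArchBlockSpace n k K) :
    twistedBlockDir n k K g (t • b) = t • twistedBlockDir n k K g b := by
  simp only [twistedBlockDir, map_smul, Matrix.mul_smul, Matrix.smul_mul]

/-- **The twisted direction has square zero** (`(g⁻¹ B g)² = g⁻¹ B² g = 0`). [folklore] -/
theorem twistedBlockDir_mul_self (g : GL (Fin n) (AdeleRing (𝓞 K) K)) (b : ArchBlockSpace n k K) :
    twistedBlockDir n k K g b * twistedBlockDir n k K g b = 0 := by
  set m : GL (Fin n) (mixedSpace K) := GLn.toMixed n K g with hm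
  have key : (m : Matrix (Fin n) (Fin n) (mixedSpace K)) *
      (((m⁻¹ : GL (Fin n) (mixedSpace K)) : Matrix (Fin n) (Fin n) (mixedSpace K))) = 1 :=
    Units.mul_inv m
  have hunf : twistedBlockDir n k K g b =
      ((m⁻¹ : GL (Fin n) (mixedSpace K)) : Matrix (Fin n) (Fin n) (mixedSpace K)) *
        blockMatrixOf n k K b * (m : Matrix (Fin n) (Fin n) (mixedSpace K)) := rfl
  rw [hunf]
  set B := blockMatrixOf n k K b with hB
  set mi : Matrix (Fin n) (Fin n) (mixedSpace K) :=
    ((m⁻¹ : GL (Fin n) (mixedSpace K)) : Matrix (Fin n) (Fin n) (mixedSpace K)) with hmi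
  calc mi * B * (m : Matrix (Fin n) (Fin n) (mixedSpace K)) * (mi * B * (m : Matrix (Fin n) (Fin n) (mixedSpace K)))
      = mi * (B * ((m : Matrix (Fin n) (Fin n) (mixedSpace K)) * mi) * B) *
          (m : Matrix (Fin n) (Fin n) (mixedSpace K)) := by
        simp only [mul_assoc]
    _ = 0 := by
        rw [key, mul_one, hB, blockMatrixOf_mul_blockMatrixOf, mul_zero, zero_mul]

/-- **The exponential of a square-zero matrix**: `exp Z = 1 + Z` if `Z² = 0` (the exponential
series stops). [folklore] -/
theorem Matrix.exp_eq_one_add_of_mul_self {N : Type*} [Fintype N] [DecidableEq N]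
    {A : Type*} [NormedCommRing A] [NormedAlgebra ℝ A] [CompleteSpace A]
    {Z : Matrix N N A} (hZ : Z * Z = 0) : NormedSpace.exp Z = 1 + Z := by
  letI : NormedRing (Matrix N N A) := Matrix.linftyOpNormedRing
  letI : NormedAlgebra ℝ (Matrix N N A) := Matrix.linftyOpNormedAlgebra
  rw [NormedSpace.exp_eq_tsum ℝ]
  change (∑' m : ℕ, ((m.factorial : ℝ)⁻¹) • Z ^ m) = 1 + Z
  have hpow : ∀ m : ℕ, m ∉ Finset.range 2 → Z ^ m = 0 := fun m hm => by
    rw [Finset.mem_range, not_lt] at hm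
    obtain ⟨j, rfl⟩ := Nat.exists_eq_add_of_le hm
    rw [pow_add, pow_two, hZ, zero_mul]
  rw [tsum_eq_sum (s := Finset.range 2) fun m hm => by rw [hpow m hm, smul_zero]]
  simp [Finset.sum_range_succ]

/-- **`exp(t X') = 1 + t X'`** for the twisted direction (square zero). [folklore] -/
theorem coe_expGL_smul_twistedBlockDir (g : GL (Fin n) (AdeleRing (𝓞 K) K)) (b : ArchBlockSpace n k K)
    (t : ℝ) :
    (expGL (t • twistedBlockDir n k K g b) : Matrix (Fin n) (Fin n) (mixedSpace K)) =
      1 + t • twistedBlockDir n k K g b := by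
  rw [coe_expGL]
  refine Matrix.exp_eq_one_add_of_mul_self ?_
  rw [Matrix.smul_mul, Matrix.mul_smul, twistedBlockDir_mul_self, smul_zero, smul_zero]

/-- **`g⁻¹ (1 + t·b) g = (exp(t X'), 1)`**: conjugating the archimedean block unipotent of the
direction `t • b` by `g` gives the archimedean one-parameter element of the twisted direction
`X' = Ad(g_∞⁻¹)(blockMatrixOf b)` (Moeglin–Waldspurger (1995), proof of Lemma I.2.10:
`exp(∑_{ℓ≠ℓ(ξ)} x_ℓ X_{iℓ}) a g exp(x_{ℓ(ξ)} X'_{iℓ(ξ)})`). [cite: MoeglinWaldspurger1995, proof of Lemma I.2.10] -/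
theorem inv_mul_archUnipotent_smul_mul (g : GL (Fin n) (AdeleRing (𝓞 K) K)) (b : ArchBlockSpace n k K)
    (t : ℝ) :
    g⁻¹ * archUnipotent n k K (t • b) * g =
      glArch n K ((archGroupGL n K).expMem (t • lieOf (twistedBlockDir n k K g b))) := by
  rw [archUnipotent_eq_ofInfinite, GLn.inv_mul_ofInfinite_mul, glArch_apply]
  congr 1
  refine Units.ext ?_
  have hval : (((archGroupGL n K).expMem (t • lieOf (twistedBlockDir n k K g b)) :
      GL (Fin n) (mixedSpace K)) : Matrix (Fin n) (Fin n) (mixedSpace K)) =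
        1 + t • twistedBlockDir n k K g b := by
    rw [RealMatrixGroup.coe_expMem]
    exact coe_expGL_smul_twistedBlockDir g b t
  rw [hval, Units.val_mul, Units.val_mul, coe_unitOneAddBlock_archBlock, map_smul, mul_add, mul_one,
    add_mul, Units.inv_mul, Matrix.mul_smul, Matrix.smul_mul]
  rfl

/-- **`(1 + (e + s b)) g = ((1 + e) g) · (exp(s X'), 1)`**: moving along the direction `b` in the
archimedean block coordinates is right translation by the archimedean one-parameter subgroup of the
twisted direction. [cite: MoeglinWaldspurger1995, proof of Lemma I.2.10] -/
theorem archUnipotent_add_smul_mul (g : GL (Fin n) (AdeleRing (𝓞 K) K)) (e b : ArchBlockSpace n k K)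
    (s : ℝ) :
    archUnipotent n k K (e + s • b) * g =
      archUnipotent n k K e * g *
        glArch n K ((archGroupGL n K).expMem (s • lieOf (twistedBlockDir n k K g b))) := by
  rw [← inv_mul_archUnipotent_smul_mul g b s, archUnipotent_add]
  simp only [mul_assoc, mul_inv_cancel_left]

end Twisted

/-! ### 4. The derivative chain along a block direction -/

section Chain

variable {n k : ℕ} {K : Type} [Field K] [NumberField K]

/-- **The derivative along a block direction is the Lie derivative along the twisted direction**
(Moeglin–Waldspurger (1995), proof of Lemma I.2.10, the integration by parts
`d/dx φ(exp(…) a g exp(x X')) = δ(X') φ(…)`): for `ψ` smooth in the archimedean variable,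
`s ↦ ψ((1 + (e + s b)) g)` has derivative `(X' ψ)((1 + (e + s b)) g)` at every `s`, where
`X' = twistedBlockDir g b` (`archUnipotent_add_smul_mul` and `IsArchSmooth.hasDerivAt_expMem_smul`).
[cite: MoeglinWaldspurger1995, proof of Lemma I.2.10] -/
theorem IsArchSmooth.hasDerivAt_archUnipotent {ψ : GL (Fin n) (AdeleRing (𝓞 K) K) → ℂ}
    (hψ : IsArchSmooth (glArch n K) ψ) (g : GL (Fin n) (AdeleRing (𝓞 K) K))
    (e b : ArchBlockSpace n k K) (s : ℝ) :
    HasDerivAt (fun s : ℝ => ψ (archUnipotent n k K (e + s • b) * g))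
      (lieDeriv (glArch n K) (lieOf (twistedBlockDir n k K g b)) ψ (archUnipotent n k K (e + s • b) * g)) s := by
  have hfun : (fun s : ℝ => ψ (archUnipotent n k K (e + s • b) * g)) = fun s : ℝ =>
      ψ (archUnipotent n k K e * g *
        glArch n K ((archGroupGL n K).expMem (s • lieOf (twistedBlockDir n k K g b)))) :=
    funext fun s => by rw [archUnipotent_add_smul_mul]
  rw [hfun, archUnipotent_add_smul_mul]
  exact hψ.hasDerivAt_expMem_smul (glArch n K) (lieOf (twistedBlockDir n k K g b)) _ s

variable (n k K) in
/-- **The chain of derivatives along a block direction**: `blockDerivChain ψ g b j = X'^j ψ`, the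
`j`-fold Lie derivative of `ψ` along the twisted direction `X' = twistedBlockDir g b`
(`iterLieDeriv` of the constant word; MW's `δ(X'^h) φ`). [cite: MoeglinWaldspurger1995, proof of Lemma I.2.10] -/
def blockDerivChain (ψ : GL (Fin n) (AdeleRing (𝓞 K) K) → ℂ) (g : GL (Fin n) (AdeleRing (𝓞 K) K))
    (b : ArchBlockSpace n k K) (j : ℕ) : GL (Fin n) (AdeleRing (𝓞 K) K) → ℂ :=
  iterLieDeriv (glArch n K) (List.replicate j (lieOf (twistedBlockDir n k K g b))) ψ

/-- `X'^0 ψ = ψ`. [folklore] -/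
@[simp]
theorem blockDerivChain_zero (ψ : GL (Fin n) (AdeleRing (𝓞 K) K) → ℂ)
    (g : GL (Fin n) (AdeleRing (𝓞 K) K)) (b : ArchBlockSpace n k K) :
    blockDerivChain n k K ψ g b 0 = ψ :=
  rfl

/-- `X'^{j+1} ψ = X' (X'^j ψ)`. [folklore] -/
theorem blockDerivChain_succ (ψ : GL (Fin n) (AdeleRing (𝓞 K) K) → ℂ)
    (g : GL (Fin n) (AdeleRing (𝓞 K) K)) (b : ArchBlockSpace n k K) (j : ℕ) :
    blockDerivChain n k K ψ g b (j + 1) =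
      lieDeriv (glArch n K) (lieOf (twistedBlockDir n k K g b)) (blockDerivChain n k K ψ g b j) :=
  rfl

/-- `blockDerivChain ψ g b j` is the iterated Lie derivative along the word `[X', …, X']` (`j` letters)
written with `List.ofFn` (the format of `IsArchSmooth.iterLieDeriv_ofFn_smul`). [folklore] -/
theorem blockDerivChain_eq_iterLieDeriv_ofFn (ψ : GL (Fin n) (AdeleRing (𝓞 K) K) → ℂ)
    (g : GL (Fin n) (AdeleRing (𝓞 K) K)) (b : ArchBlockSpace n k K) (j : ℕ) :
    blockDerivChain n k K ψ g b j =
      iterLieDeriv (glArch n K) (List.ofFn fun _ : Fin j => lieOf (twistedBlockDir n k K g b)) ψ := by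
  rw [blockDerivChain, List.ofFn_const]

/-- The functions of the chain are smooth in the archimedean variable. [folklore] -/
theorem isArchSmooth_blockDerivChain {ψ : GL (Fin n) (AdeleRing (𝓞 K) K) → ℂ}
    (hψ : IsArchSmooth (glArch n K) ψ) (g : GL (Fin n) (AdeleRing (𝓞 K) K))
    (b : ArchBlockSpace n k K) (j : ℕ) :
    IsArchSmooth (glArch n K) (blockDerivChain n k K ψ g b j) :=
  hψ.iterLieDeriv_gl _

/-- **The derivative chain along a block direction** (the input format of the torus lemma
`norm_sub_le_sum_of_derivChains` of `PeriodicDerivativeChain`): for `ψ` smooth in the archimedean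
variable and every `j`, `s ↦ (X'^j ψ)((1 + (e + s b)) g)` has derivative
`(X'^{j+1} ψ)((1 + (e + s b)) g)` at every `s`. [cite: MoeglinWaldspurger1995, proof of Lemma I.2.10] -/
theorem IsArchSmooth.hasDerivAt_blockDerivChain {ψ : GL (Fin n) (AdeleRing (𝓞 K) K) → ℂ}
    (hψ : IsArchSmooth (glArch n K) ψ) (g : GL (Fin n) (AdeleRing (𝓞 K) K))
    (e b : ArchBlockSpace n k K) (j : ℕ) (s : ℝ) :
    HasDerivAt (fun s : ℝ => blockDerivChain n k K ψ g b j (archUnipotent n k K (e + s • b) * g))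
      (blockDerivChain n k K ψ g b (j + 1) (archUnipotent n k K (e + s • b) * g)) s :=
  (isArchSmooth_blockDerivChain hψ g b j).hasDerivAt_archUnipotent g e b s

end Chain

end Literature.NumberTheory.Automorphic
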